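import Literature.Probability.LatticeModels.FKFreeArcPassage
import HarnessLib

/-!
# The FK interface visits every pillar standing on the free arc whose top is joined to the wired arc

Topic `Literature/Probability/LatticeModels`; part of the discharge programme for the named fact
`fkIsing_rsw` (Duminil-Copin–Hongler–Nolin 2011, Thm. 1 / Duminil-Copin–Smirnov 2012, Thm. 3.16),
companion of `FKFreeArcPassage.lean`. In the proof of DCHN's Lemma 15 for balls (Duminil-Copin 2013,
Lemma 10.7) one explores the interface of a Dobrushin domain up to the hitting time `T` of the
medial edges bordering a half-ball `B_k(x)` sitting on the free arc, and uses that "`B_k(x)` is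
connected to the wired arc if and only if `T < ∞`". This file proves the non-trivial inclusion in
the tree's language (`exists_lt_exitTime_cornerOrbit_fst_eq_pillarSite`): if the top of a vertical
pillar of sites `u, u + e₁, …, u + m e₁` (all of whose faces `faceAt · 0`, `faceAt · 3` are inner,
the bottom face `faceAt u 3` being chained to the face of the start corner through closed common
sides — e.g. along the free arc) is joined to the arc `A` by open edges of the completed
configuration, then before its exit the exploration visits a corner at a site of the pillar. The
proof is the winding-number argument of `FKFreeArcPassage.exists_lt_exitTime_cornerOrbit_eq`
(closed perturbed polygon of the interface cycle, `MedialCycleSeparation`), run down the pillar: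
the face `faceAt (u + (i+1) e₁) 3 = faceAt (u + i e₁) 0` links consecutive sites. Applied to the
pillar below a ball site joined to the wired arc it gives `{B_k(x) ↔ A} ⊆ {T < exit}`
(`FKIsingBallArmReduction.lean`). Theorems only; no named fact is introduced.

## References

* H. Duminil-Copin, C. Hongler, P. Nolin, *Connection probabilities and RSW-type bounds for the
  two-dimensional FK Ising model*, Comm. Pure Appl. Math. 64 (2011) 1165–1198 (arXiv:0912.4253),
  §4, proof of Lemma 15 — bib key `DuminilCopinHonglerNolin2011`.
* H. Duminil-Copin, S. Smirnov, *Conformal invariance of lattice models*, Clay Math. Proc. 15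
  (2012), §6.2 — bib key `DuminilCopinSmirnov2012Clay`.
-/

noncomputable section

open Set Complex Literature.Topology.PlaneTopology

namespace Literature.Probability.LatticeModels

section Domain

variable {D : DiscreteDobrushin} (hD : D.IsZdAdmissible) (ω : Percolation.BondConfig (Site 2))

/-- The `i`-th site of the vertical pillar above `u`: `u + i e₁`. [folklore] -/
def pillarSite (u : Site 2) (i : ℕ) : Site 2 := u + (i : ℤ) • (Pi.single 1 1 : Site 2)

/-- The pillar starts at `u`. [folklore] -/
@[simp] theorem pillarSite_zero (u : Site 2) : pillarSite u 0 = u := by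
  simp [pillarSite]

/-- The face below-right of the next pillar site is the face at the current one:
`faceAt (u + (i+1) e₁) 3 = faceAt (u + i e₁) 0`. [folklore] -/
theorem faceAt_pillarSite_succ_three (u : Site 2) (i : ℕ) :
    faceAt (pillarSite u (i + 1)) 3 = faceAt (pillarSite u i) 0 := by
  simp only [faceAt, pillarSite, cornerOff]
  push_cast
  rw [add_smul, one_smul]
  abel

include hD in
/-- **The interface visits every pillar on the free side whose top is joined to the wired arc.**
Let the wired arc be connected through the domain (H1); let `u, u + e₁, …, u + m e₁` be a pillar of
sites all of whose faces `faceAt · 0` and `faceAt · 3` are inner, whose bottom face `faceAt u 3` is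
joined to the face of the start corner by a chain of adjacent faces with closed common sides (e.g.
along the free arc), and whose top site is joined to the arc `A` by open edges of the completed
configuration. Then before its exit the interface visits a corner at some site of the pillar.
Proof, by the winding number of the closed perturbed polygon of the interface cycle
(`FKFreeArcPassage`): it separates the start vertex from the start face; it is constant on the open
cluster of the top site (equal there to its value about the start vertex) and along the chain of
faces (equal at the bottom face to its value about the start face); if no corner `(u + i e₁, 3)`,
`(u + i e₁, 0)` were on the cycle, the values about consecutive pillar sites would agree through
the face between them (`faceAt (u + (i+1) e₁) 3 = faceAt (u + i e₁) 0`), and the value about `u`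
would agree with that about the bottom face — a contradiction. This is the form in which "the ball
`B_k(x)` is connected to the wired arc iff the exploration path reaches the medial edges bordering
its vertices" (Duminil-Copin 2013, proof of Lemma 10.7; DCHN 2011, proof of Lemma 15) enters the
tree: apply it to the pillar below a ball vertex joined to the wired arc.
[cite: DuminilCopinHonglerNolin2011, §4, proof of Lemma 15] -/
theorem exists_lt_exitTime_cornerOrbit_fst_eq_pillarSite
    (hA1 : ((discreteDomainGraph D.Ω D.δ).induce D.zdArcA).Preconnected)
    (u : Site 2) (m : ℕ)
    (hinner0 : ∀ i ≤ m, D.IsInnerFace (faceAt (pillarSite u i) 0))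
    (hinner3 : ∀ i ≤ m, D.IsInnerFace (faceAt (pillarSite u i) 3))
    (hchain : Relation.ReflTransGen (fun f g : Site 2 ↦ (zdGraph 2).Adj f g ∧
        ∀ v w : Site 2, IsCorner v f → IsCorner v g → IsCorner w f → IsCorner w g → v ≠ w →
          s(v, w) ∉ D.bcBondConfig ω)
        (cFace (DiscreteDobrushin.startCorner hD)) (faceAt u 3))
    (hreach : ∃ a ∈ D.zdArcA, (Percolation.openGraph (D.bcBondConfig ω)).Reachable (pillarSite u m) a) :
    ∃ j < DiscreteDobrushin.exitTime hD ω, ∃ i ≤ m,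
      (cornerOrbit (D.bcBondConfig ω) (DiscreteDobrushin.startCorner hD) j).1 = pillarSite u i := by
  classical
  set c₀ := DiscreteDobrushin.startCorner hD with hc₀def
  have hc₀ : D.IsStartCorner c₀ := DiscreteDobrushin.isStartCorner_startCorner hD
  set β := D.bcBondConfig ω with hβdef
  have hβ : β ⊆ (zdGraph 2).edgeSet := bcBondConfig_subset_zdGraph ω
  -- the minimal period
  have hex : ∃ P, 0 < P ∧ cornerOrbit β c₀ P = c₀ := exists_cornerOrbit_startCorner_eq hD ω
  obtain ⟨hP0, hP⟩ := Nat.find_spec hex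
  have hPmin : ∀ s, 0 < s → s < Nat.find hex → cornerOrbit β c₀ s ≠ c₀ :=
    fun s hs hsP h ↦ Nat.find_min hex hsP ⟨hs, h⟩
  obtain ⟨n, hn⟩ : ∃ n, Nat.find hex = n + 1 := ⟨Nat.find hex - 1, by omega⟩
  rw [hn] at hP hPmin
  -- winding numbers
  have hsep := wind_cyLoop_fst_ne_faceCenter hP hPmin
  obtain ⟨a, ha, hxa⟩ := hreach
  have hxc : (Percolation.openGraph β).Reachable (pillarSite u m) c₀.1 :=
    hxa.trans (reachable_of_mem_zdArcA ω hA1 ha hc₀.mem_zdArcA)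
  have hwx := wind_cyLoop_eq_of_reachable hβ hP hxc
  have hwchain : ∀ g : Site 2, Relation.ReflTransGen (fun f g : Site 2 ↦ (zdGraph 2).Adj f g ∧
      ∀ v w : Site 2, IsCorner v f → IsCorner v g → IsCorner w f → IsCorner w g → v ≠ w →
        s(v, w) ∉ β) (cFace c₀) g →
      wind (fun t => (cyLoop n hP).extend t - faceCenter (cFace c₀)) =
        wind (fun t => (cyLoop n hP).extend t - faceCenter g) := by
    intro g hg
    induction hg with
    | refl => rfl
    | tail _ hfg ih => exact ih.trans (wind_cyLoop_faceCenter_eq_of_adj hP hfg.1 hfg.2)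
  have hwf := hwchain _ hchain
  -- if no pillar corner were on the cycle before the exit
  by_contra hno
  push Not at hno
  have hne : ∀ i ≤ m, ∀ k : Fin 4, (k = 0 ∨ k = 3) → ∀ s ≤ n, cornerOrbit β c₀ s ≠ (pillarSite u i, k) := by
    intro i hi k hk s hs h
    rcases lt_or_ge s (DiscreteDobrushin.exitTime hD ω) with hlt | hge
    · exact hno s hlt i hi (by rw [h])
    · have := not_isInnerFace_of_exitTime_le hD ω hPmin hge hs
      rw [h] at this
      rcases hk with rfl | rfl
      · exact this (hinner0 i hi)
      · exact this (hinner3 i hi)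
  -- the winding number about every pillar site equals that about `u`
  have hdown : ∀ i ≤ m, wind (fun t => (cyLoop n hP).extend t - Site.toComplex (pillarSite u i)) =
      wind (fun t => (cyLoop n hP).extend t - Site.toComplex u) := by
    intro i
    induction i with
    | zero => intro; simp
    | succ i ih =>
      intro hi
      rw [← ih (by omega), wind_cyLoop_eq_faceCenter_of_forall_ne hP (hne (i + 1) hi 3 (Or.inr rfl)),
        faceAt_pillarSite_succ_three, ← wind_cyLoop_eq_faceCenter_of_forall_ne hP (hne i (by omega) 0 (Or.inl rfl))]
  have hbottom := wind_cyLoop_eq_faceCenter_of_forall_ne hP (hne 0 (Nat.zero_le m) 3 (Or.inr rfl))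
  rw [pillarSite_zero] at hbottom
  exact hsep (hwx.symm.trans ((hdown m le_rfl).trans (hbottom.trans hwf.symm)))

end Domain

end Literature.Probability.LatticeModels
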